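/-
Copyright: the b2b-balaban T⁴-continuum CRUX team, row NE7b OWNER lineage `t4-ne7b-p1` (gen 122). Project licence.
-/
import Summits.QuantumFields.BalabanUV.T4Continuum.Spine.NE7b.SupTorusPerturbedCoarseFloor
import Summits.QuantumFields.BalabanUV.T4Continuum.Spine.NE7b.SupTorusPerturbedProfile
import Summits.QuantumFields.BalabanUV.T4Continuum.Spine.NE7b.SupTorusResponseLocality

/-!
# THE RESPONSE OF THE PERTURBED ROAD IS EXPONENTIALLY LOCAL — (137) `response_local` RE-RUN for `H + K`: the superposition
# `h_{y₀} := Σ_{y′} T_K⁻¹(y′,y₀)·ψ^K_{y′}` of the perturbed block columns has block means `e_{y₀}`, satisfies `(H + K)h_{y₀} = T_K⁻¹(bt ·, y₀)`,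
# and its block mean squares decay: `(n+1)^{−d}Σ_{B_y}h_{y₀}² ≤ C·e^{−2δρ_s(y,y₀)}` with `(C, δ)` functions of `(d, a, λ, Λ, ε, γ)` ALONE
# (row NE7b, node U5c; (137)∕(166)∕(167) BY NAME; [folklore])

Cell `pub-balaban`, sub-cell `t4`, spine estimate NE7b (`T4WeightBudget.RelWeightBound`; the cell's OWN estimate — NOT PRINTED in
[Bałaban 1983–89], NOT PROVED).  Crux-route work under `Spine/NE7b/` by the row OWNER (`t4-ne7b-p1` gen 122, file (168)) under FREEZE
(0)'s crux-prover clause; NOTHING of Bałaban's is named as a Lean object, valued or asserted; no `T4Continuum/Support` leaf typed; no `def`,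
no notation; zero `sorry`.  Imports (BY NAME): the OWNER's (166) `…SupTorusPerturbedCoarseFloor` (`perturbed_action_sum_smul`,
`perturbed_coarse_floor`, `perturbed_nextScale_hessian_local`), (167) `…SupTorusPerturbedProfile` (`perturbed_blockSq_le_of_decaying_source`),
(137) `…SupTorusResponseLocality` (`rate_mono`; through it (131) `exists_rate`).

WHY (located).  (137) assembled the road's response `Dt e_{y₀} = Σ_{y′}T⁻¹(y′,y₀)ψ_{y′}` from the block columns and proved its block `ℓ²`
decay from (135) (decay of `T⁻¹`) and the block-constant source lemma.  For the perturbed Hessian `H + K` — the class the road's own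
step produces ((102)∕(135): the next action's Hessian is `(n+1)^d T⁻¹`, a local kernel, not a potential) — (166) is (135) and (167) §2 is
the source lemma; this file is (137)'s assembly, word for word, with the kernel-sum `εK_{γ−κ}` subtracted from the floor.  With it the
response letter ITERATES along the road unconditionally.

WHAT IS PROVED ([folklore]; fine torus `Site d ((n+1)s)`, coarse `Site d s`; `(H + K)u` DISPLAYED; `K_α := (2∕(1 − e^{−α}))^d`;
`T_K(y,y′) := (n+1)^{−d}Σ_z ψ^K_{y′}(σ(chart (wm y) z))` as `Matrix.of`, `T_K⁻¹` Mathlib's inverse):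
* §1 `kernelSum_anti` (`K_α` antitone in `α > 0`); `perturbed_superposition_equation` (`(H + K)(Σ_{y′}c_{y′}ψ^K_{y′}) = c∘bt`).
* §2 (`a > 0`, `Λ ≥ 0`, `ε ≥ 0`, `γ > 0`, `λ + εK_γ ≤ min(2,a)`, `−λ ≤ V ≤ Λ`, `K` symmetric, `|K| ≤ εe^{−γρ_N}`):
  `perturbed_schur_mulVec_injective` (`T_K` injective, from (166)'s coarse floor — hence invertible, as (138) `schur_det_isUnit`);
  `perturbed_response_blockMean` (`Q′t h_{y₀} = e_{y₀}`).
* §3 **`perturbed_response_local`** (HEADLINE; `a > 0`, `λ < min(2,a)`, `Λ ≥ 0`, `ε ≥ 0`, `γ > 1`, `εK_{γ−1} ≤ (min(2,a) − λ)∕4`):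
  THERE ARE `C, δ > 0` such that for ALL `n, s`, ALL `−λ ≤ V ≤ Λ`, ALL symmetric `|K| ≤ εe^{−γρ_N}` and their block columns `ψ^K`:
  (i) `Q′t h_{y₀} = e_{y₀}`, (ii) `(H + K)h_{y₀} = T_K⁻¹(bt ·, y₀)`, (iii) `(n+1)^{−d}Σ_{B_y}h_{y₀}² ≤ C·e^{−2δρ_s(y,y₀)}` for every block `y`.
* §4 toy.

HONEST (what this is NOT).  The response letter for `H + K` on a FINITE torus; the covariance ∕ pointwise ∕ volume letters for `H + K`
remain by-name re-runs; cubic periods; scalar skeleton ((A3), NC-NE7b-α UNRULED); nothing of Bałaban's.  BY-NAME EFFECT ON THE WALL: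
NONE.  NE7b NOT PRINTED ∕ NOT PROVED; spine PROVED 0∕9; rung (B)+1 on a FINITE torus — NOT infinite volume, NOT the mass gap, NOT Clay.
HONEST DEPENDENCY: continuum YM on T⁴ ⇐ BetaPertH ∧ nine spine estimates (0∕9 proved); BetaPertH ⇐ (D1) ∧ (D4) ∧ CAP+tail; G-an2-4
gates asym, D1 and NE2∕3∕4.
-/

set_option autoImplicit false

noncomputable section

namespace Summit.QuantumFields.BalabanUV.T4Continuum.NE7b.SupTorusPerturbedResponse

open Real
open Literature.MathematicalPhysics.QuantumFieldTheory.Balaban1983to89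
open B6QGQLower276 (X e blk B side chart mem_B sum_B sum_B_const card_cube blk_chart)
open Beta (Site siteOf windowMap siteOf_windowMap siteOf_add)
open SupTorusHessianCombesThomas (exists_rate)
open SupTorusResponseLocality (rate_mono)
open SupTorusPerturbedCoarseFloor (perturbed_action_sum_smul perturbed_coarse_floor perturbed_nextScale_hessian_local)
open SupTorusPerturbedProfile (perturbed_blockSq_le_of_decaying_source)

variable {d : ℕ}

/-! ## §1. The kernel sum is antitone in the rate; superpositions of block columns -/

/-- `K_α = (2∕(1 − e^{−α}))^d` is antitone in the rate: `0 < α ≤ β` ⟹ `K_β ≤ K_α`. [folklore] -/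
theorem kernelSum_anti {α β : ℝ} (hα : 0 < α) (hαβ : α ≤ β) :
    (2 * (1 - exp (-β))⁻¹) ^ d ≤ (2 * (1 - exp (-α))⁻¹) ^ d := by
  have h1 : 0 < 1 - exp (-α) := sub_pos.2 (exp_lt_one_iff.2 (by linarith))
  have h2 : 1 - exp (-α) ≤ 1 - exp (-β) := by linarith [exp_le_exp.2 (neg_le_neg hαβ)]
  have h3 : 0 < 1 - exp (-β) := lt_of_lt_of_le h1 h2
  exact pow_le_pow_left₀ (mul_nonneg zero_le_two (inv_nonneg.2 h3.le)) (mul_le_mul_of_nonneg_left (inv_anti₀ h1 h2) zero_le_two) d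

section Columns

variable (n : ℕ) (a : ℝ) (s : ℕ) [NeZero s] (ha : 0 < a) {lam Lam ε γ : ℝ} (hLam : 0 ≤ Lam) (hε : 0 ≤ ε) (hγ : 0 < γ)
  (hlam : lam + ε * (2 * (1 - exp (-γ))⁻¹) ^ d ≤ min 2 a)
  (V : Site d ((n + 1) * s) → ℝ) (hV : ∀ x, -lam ≤ V x) (hV' : ∀ x, V x ≤ Lam)
  (K : Site d ((n + 1) * s) → Site d ((n + 1) * s) → ℝ) (hKs : ∀ x z, K x z = K z x)
  (hK : ∀ x z, |K x z| ≤ ε * exp (-(γ * ∑ i, (((x i - z i).valMinAbs.natAbs : ℕ) : ℝ))))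
  (ψ : Site d s → Site d ((n + 1) * s) → ℝ)
  (hψ : ∀ y' x, ((n : ℝ) + 1) ^ 2 * ∑ μ, (2 * ψ y' x - ψ y' (x + siteOf d ((n + 1) * s) (e μ)) - ψ y' (x - siteOf d ((n + 1) * s) (e μ)))
      + a / ((n : ℝ) + 1) ^ d * ∑ q ∈ B n (blk n (windowMap d ((n + 1) * s) x)), ψ y' (siteOf d ((n + 1) * s) q) + V x * ψ y' x
      + ∑ z, K x z * ψ y' z = if siteOf d s (blk n (windowMap d ((n + 1) * s) x)) = y' then 1 else 0)

include hψ in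
/-- **SUPERPOSITIONS OF BLOCK COLUMNS**: `(H + K)(Σ_{y′} c_{y′}ψ^K_{y′}) = c∘bt` — the perturbed action of a coarse superposition of the
block columns is the block-constant lift of its coefficients ((166) `perturbed_action_sum_smul`). [folklore] -/
theorem perturbed_superposition_equation (c : Site d s → ℝ) (x : Site d ((n + 1) * s)) :
    ((n : ℝ) + 1) ^ 2 * ∑ μ, (2 * (∑ y', c y' * ψ y' x) - (∑ y', c y' * ψ y' (x + siteOf d ((n + 1) * s) (e μ)))
          - (∑ y', c y' * ψ y' (x - siteOf d ((n + 1) * s) (e μ))))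
        + a / ((n : ℝ) + 1) ^ d * ∑ q ∈ B n (blk n (windowMap d ((n + 1) * s) x)), (∑ y', c y' * ψ y' (siteOf d ((n + 1) * s) q))
        + V x * (∑ y', c y' * ψ y' x) + ∑ z, K x z * (∑ y', c y' * ψ y' z)
      = c (siteOf d s (blk n (windowMap d ((n + 1) * s) x))) := by
  rw [perturbed_action_sum_smul n a s Finset.univ c ψ V K x]
  simp only [hψ, mul_ite, mul_one, mul_zero]
  rw [Finset.sum_ite_eq, if_pos (Finset.mem_univ _)]

/-! ## §2. `T_K` is invertible; the block means of the response -/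

include ha hLam hε hγ hlam hV hV' hKs hK hψ in
/-- **`T_K` IS INJECTIVE** (`λ + εK_γ ≤ min(2,a)`): a vector in the kernel of `T_K` has form `0`, and (166)'s coarse floor
`Σg²∕(36^d(4d + a + Λ + εK_γ)) ≤ ⟨g, T_K g⟩` forces `g = 0`. [folklore] -/
theorem perturbed_schur_mulVec_injective :
    Function.Injective (Matrix.of fun y y' : Site d s =>
      (((n : ℝ) + 1) ^ d)⁻¹ * ∑ z : Fin d → Fin (n + 1), ψ y' (siteOf d ((n + 1) * s) (chart n (windowMap d s y) z))).mulVec := by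
  classical
  set T : Matrix (Site d s) (Site d s) ℝ := Matrix.of fun y y' : Site d s =>
    (((n : ℝ) + 1) ^ d)⁻¹ * ∑ z : Fin d → Fin (n + 1), ψ y' (siteOf d ((n + 1) * s) (chart n (windowMap d s y) z)) with hT_def
  have hd : (0 : ℝ) ≤ d := Nat.cast_nonneg d
  have hfloor := perturbed_coarse_floor n a s ha hLam hε hγ hlam V hV hV' K hKs hK ψ hψ
  intro g₁ g₂ hg
  have hg0 : T.mulVec (g₁ - g₂) = 0 := by rw [Matrix.mulVec_sub, hg, sub_self]
  have hq : ∑ y, (g₁ - g₂) y * T.mulVec (g₁ - g₂) y = 0 := by rw [hg0]; simp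
  have hfl := hfloor (g₁ - g₂)
  have hform : ∑ y, (g₁ - g₂) y * ∑ y', ((((n : ℝ) + 1) ^ d)⁻¹
      * ∑ z : Fin d → Fin (n + 1), ψ y' (siteOf d ((n + 1) * s) (chart n (windowMap d s y) z))) * (g₁ - g₂) y'
      = ∑ y, (g₁ - g₂) y * T.mulVec (g₁ - g₂) y := by
    simp only [hT_def, Matrix.mulVec, dotProduct, Matrix.of_apply]
  rw [hform, hq] at hfl
  have hK0 : 0 ≤ ε * (2 * (1 - exp (-γ))⁻¹) ^ d :=
    mul_nonneg hε (pow_nonneg (mul_nonneg zero_le_two (inv_nonneg.2 (sub_nonneg.2 (exp_le_one_iff.2 (by linarith))))) d)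
  have hpos : 0 < 1 / ((36 : ℝ) ^ d * (4 * d + a + Lam + ε * (2 * (1 - exp (-γ))⁻¹) ^ d)) :=
    div_pos one_pos (mul_pos (pow_pos (by norm_num) d) (add_pos_of_pos_of_nonneg (by positivity) hK0))
  have hS : ∑ y, (g₁ - g₂) y ^ 2 ≤ 0 := not_lt.1 fun hne => (not_le.2 (mul_pos hpos hne)) hfl
  funext y
  have hy : (g₁ - g₂) y ^ 2 ≤ 0 := (Finset.single_le_sum (fun y _ => sq_nonneg ((g₁ - g₂) y)) (Finset.mem_univ y)).trans hS
  have : (g₁ - g₂) y = 0 := by nlinarith [sq_nonneg ((g₁ - g₂) y)]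
  simpa [sub_eq_zero] using this

include ha hLam hε hγ hlam hV hV' hKs hK hψ in
/-- **THE BLOCK MEANS OF THE RESPONSE**: `Q′t(Σ_{y′}T_K⁻¹(y′,y₀)ψ^K_{y′}) = e_{y₀}` — `det T_K` is a unit (injective `mulVec`, Mathlib
`Matrix.mulVec_injective_iff_isUnit`; cf. (138) `schur_det_isUnit` for `K = 0`), and this is the `(y, y₀)` entry of `T_K·T_K⁻¹ = 1`. [folklore] -/
theorem perturbed_response_blockMean (y₀ y : Site d s) :
    (((n : ℝ) + 1) ^ d)⁻¹ * ∑ z : Fin d → Fin (n + 1), (∑ y', (Matrix.of fun yy y'' : Site d s =>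
        (((n : ℝ) + 1) ^ d)⁻¹ * ∑ z : Fin d → Fin (n + 1), ψ y'' (siteOf d ((n + 1) * s) (chart n (windowMap d s yy) z)))⁻¹ y' y₀
      * ψ y' (siteOf d ((n + 1) * s) (chart n (windowMap d s y) z))) = if y = y₀ then 1 else 0 := by
  classical
  have hunit := (Matrix.isUnit_iff_isUnit_det _).1
    (Matrix.mulVec_injective_iff_isUnit.1 (perturbed_schur_mulVec_injective n a s ha hLam hε hγ hlam V hV hV' K hKs hK ψ hψ))
  set T : Matrix (Site d s) (Site d s) ℝ := Matrix.of fun yy y'' : Site d s =>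
    (((n : ℝ) + 1) ^ d)⁻¹ * ∑ z : Fin d → Fin (n + 1), ψ y'' (siteOf d ((n + 1) * s) (chart n (windowMap d s yy) z)) with hT_def
  have h1 : (T * T⁻¹) y y₀ = if y = y₀ then 1 else 0 := by rw [Matrix.mul_nonsing_inv T hunit, Matrix.one_apply]
  rw [← h1, Matrix.mul_apply]
  simp only [hT_def, Matrix.of_apply, Finset.mul_sum, Finset.sum_mul]
  rw [Finset.sum_comm]
  exact Finset.sum_congr rfl fun y' _ => Finset.sum_congr rfl fun z _ => by ring

end Columns

/-! ## §3. THE END: the response of `H + K` is exponentially local, with constants of `(d, a, λ, Λ, ε, γ)` alone -/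

/-- **HEADLINE — THE RESPONSE OF THE PERTURBED ROAD IS EXPONENTIALLY LOCAL, UNCONDITIONALLY.**  Fix `d`, `a > 0`, `λ < min(2,a)`,
`Λ ≥ 0`, a kernel rate `γ > 1` and size `ε ≥ 0` with `εK_{γ−1} ≤ (min(2,a) − λ)∕4`.  THERE ARE `C, δ > 0` such that for ALL `n, s`, ALL
`−λ ≤ V ≤ Λ`, ALL symmetric kernels `|K(x,z)| ≤ εe^{−γρ_N(x,z)}` and their block columns `ψ^K` (`(H + K)ψ^K_{y′} = 𝟙[bt · = y′]`), the
superposition `h_{y₀} := Σ_{y′}T_K⁻¹(y′,y₀)ψ^K_{y′}` satisfies (i) `Q′t h_{y₀} = e_{y₀}`, (ii) `(H + K)h_{y₀} = T_K⁻¹(bt ·, y₀)` — the two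
displays DEFINING the perturbed road's response — and (iii) `(n+1)^{−d}Σ_z h_{y₀}(σ(chart (wm y) z))² ≤ C·e^{−2δρ_s(y,y₀)}` for every block
`y` ((137) by name: (131) `exists_rate`, (166) `perturbed_nextScale_hessian_local`, (167) §2). [folklore] -/
theorem perturbed_response_local (a : ℝ) (ha : 0 < a) {lam Lam ε γ : ℝ} (hm0 : 0 < min 2 a - lam) (hLam : 0 ≤ Lam)
    (hε : 0 ≤ ε) (hγ : 1 < γ) (hεs : ε * (2 * (1 - exp (-(γ - 1)))⁻¹) ^ d ≤ (min 2 a - lam) / 4) :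
    ∃ C δ : ℝ, 0 < C ∧ 0 < δ ∧ ∀ (n s : ℕ) [NeZero s] (V : Site d ((n + 1) * s) → ℝ), (∀ x, -lam ≤ V x) → (∀ x, V x ≤ Lam) →
      ∀ K : Site d ((n + 1) * s) → Site d ((n + 1) * s) → ℝ, (∀ x z, K x z = K z x) →
      (∀ x z, |K x z| ≤ ε * exp (-(γ * ∑ i, (((x i - z i).valMinAbs.natAbs : ℕ) : ℝ)))) →
      ∀ ψ : Site d s → Site d ((n + 1) * s) → ℝ,
      (∀ y' x, ((n : ℝ) + 1) ^ 2 * ∑ μ, (2 * ψ y' x - ψ y' (x + siteOf d ((n + 1) * s) (e μ)) - ψ y' (x - siteOf d ((n + 1) * s) (e μ)))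
        + a / ((n : ℝ) + 1) ^ d * ∑ q ∈ B n (blk n (windowMap d ((n + 1) * s) x)), ψ y' (siteOf d ((n + 1) * s) q) + V x * ψ y' x
        + ∑ z, K x z * ψ y' z = if siteOf d s (blk n (windowMap d ((n + 1) * s) x)) = y' then 1 else 0) →
      ∀ y₀ : Site d s,
        (∀ y : Site d s, (((n : ℝ) + 1) ^ d)⁻¹ * ∑ z : Fin d → Fin (n + 1), (∑ y', (Matrix.of fun yy y'' : Site d s =>
              (((n : ℝ) + 1) ^ d)⁻¹ * ∑ z : Fin d → Fin (n + 1), ψ y'' (siteOf d ((n + 1) * s) (chart n (windowMap d s yy) z)))⁻¹ y' y₀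
            * ψ y' (siteOf d ((n + 1) * s) (chart n (windowMap d s y) z))) = if y = y₀ then 1 else 0) ∧
        (∀ x : Site d ((n + 1) * s),
          ((n : ℝ) + 1) ^ 2 * ∑ μ, (2 * (∑ y', (Matrix.of fun yy y'' : Site d s =>
              (((n : ℝ) + 1) ^ d)⁻¹ * ∑ z : Fin d → Fin (n + 1), ψ y'' (siteOf d ((n + 1) * s) (chart n (windowMap d s yy) z)))⁻¹ y' y₀
              * ψ y' x)
            - (∑ y', (Matrix.of fun yy y'' : Site d s =>
              (((n : ℝ) + 1) ^ d)⁻¹ * ∑ z : Fin d → Fin (n + 1), ψ y'' (siteOf d ((n + 1) * s) (chart n (windowMap d s yy) z)))⁻¹ y' y₀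
              * ψ y' (x + siteOf d ((n + 1) * s) (e μ)))
            - (∑ y', (Matrix.of fun yy y'' : Site d s =>
              (((n : ℝ) + 1) ^ d)⁻¹ * ∑ z : Fin d → Fin (n + 1), ψ y'' (siteOf d ((n + 1) * s) (chart n (windowMap d s yy) z)))⁻¹ y' y₀
              * ψ y' (x - siteOf d ((n + 1) * s) (e μ))))
          + a / ((n : ℝ) + 1) ^ d * ∑ q ∈ B n (blk n (windowMap d ((n + 1) * s) x)), (∑ y', (Matrix.of fun yy y'' : Site d s =>
              (((n : ℝ) + 1) ^ d)⁻¹ * ∑ z : Fin d → Fin (n + 1), ψ y'' (siteOf d ((n + 1) * s) (chart n (windowMap d s yy) z)))⁻¹ y' y₀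
              * ψ y' (siteOf d ((n + 1) * s) q))
          + V x * (∑ y', (Matrix.of fun yy y'' : Site d s =>
              (((n : ℝ) + 1) ^ d)⁻¹ * ∑ z : Fin d → Fin (n + 1), ψ y'' (siteOf d ((n + 1) * s) (chart n (windowMap d s yy) z)))⁻¹ y' y₀
              * ψ y' x)
          + ∑ z, K x z * (∑ y', (Matrix.of fun yy y'' : Site d s =>
              (((n : ℝ) + 1) ^ d)⁻¹ * ∑ z : Fin d → Fin (n + 1), ψ y'' (siteOf d ((n + 1) * s) (chart n (windowMap d s yy) z)))⁻¹ y' y₀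
              * ψ y' z)
          = (Matrix.of fun yy y'' : Site d s =>
              (((n : ℝ) + 1) ^ d)⁻¹ * ∑ z : Fin d → Fin (n + 1), ψ y'' (siteOf d ((n + 1) * s) (chart n (windowMap d s yy) z)))⁻¹
              (siteOf d s (blk n (windowMap d ((n + 1) * s) x))) y₀) ∧
        (∀ y : Site d s, (((n : ℝ) + 1) ^ d)⁻¹ * ∑ z : Fin d → Fin (n + 1), (∑ y', (Matrix.of fun yy y'' : Site d s =>
              (((n : ℝ) + 1) ^ d)⁻¹ * ∑ z : Fin d → Fin (n + 1), ψ y'' (siteOf d ((n + 1) * s) (chart n (windowMap d s yy) z)))⁻¹ y' y₀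
            * ψ y' (siteOf d ((n + 1) * s) (chart n (windowMap d s y) z))) ^ 2
          ≤ C * exp (-(2 * δ * ∑ i, (((y i - y₀ i).valMinAbs.natAbs : ℕ) : ℝ)))) := by
  classical
  have hd : (0 : ℝ) ≤ d := Nat.cast_nonneg d
  -- the rates: `κ₀` from (131), `(c₁, δ₁)` from (166), `κ = min(κ₀, δ₁∕2)`
  obtain ⟨κ₀, hκ₀0, hκ₀1, hκ₀m⟩ := exists_rate (d := d) a ha.le hm0
  obtain ⟨c₁, δ₁, hc₁, hδ₁, H166⟩ := perturbed_nextScale_hessian_local (d := d) a ha hm0 hLam hε hγ hεs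
  set κ : ℝ := min κ₀ (δ₁ / 2) with hκ_def
  have hκ0 : 0 < κ := lt_min hκ₀0 (by linarith)
  have hκ1 : κ ≤ 1 := (min_le_left _ _).trans hκ₀1
  have hκγ : κ < γ := lt_of_le_of_lt hκ1 hγ
  have h2κ : 2 * κ ≤ δ₁ := by have := min_le_right κ₀ (δ₁ / 2); rw [← hκ_def] at this; linarith
  have hmκ : (min 2 a - lam) / 2 ≤ min 2 a - lam - 2 * d * κ ^ 2 - a * (exp (2 * d * κ) - 1) :=
    hκ₀m.trans (rate_mono (d := d) a ha.le hκ0.le (min_le_left _ _))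
  -- the kernel sums at the rates `γ − κ` and `γ` are at most `K_{γ−1} ≤ (min(2,a) − λ)∕(4ε)`
  have hr1 : ε * (2 * (1 - exp (-(γ - κ)))⁻¹) ^ d ≤ (min 2 a - lam) / 4 :=
    (mul_le_mul_of_nonneg_left (kernelSum_anti (d := d) (by linarith) (by linarith)) hε).trans hεs
  have hr2 : ε * (2 * (1 - exp (-γ))⁻¹) ^ d ≤ (min 2 a - lam) / 4 :=
    (mul_le_mul_of_nonneg_left (kernelSum_anti (d := d) (by linarith) (by linarith)) hε).trans hεs
  have hm : ε * (2 * (1 - exp (-(γ - κ)))⁻¹) ^ d < min 2 a - lam - 2 * d * κ ^ 2 - a * (exp (2 * d * κ) - 1) := by linarith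
  have hfl : (min 2 a - lam) / 4
      ≤ min 2 a - lam - 2 * d * κ ^ 2 - a * (exp (2 * d * κ) - 1) - ε * (2 * (1 - exp (-(γ - κ)))⁻¹) ^ d := by linarith
  have hlam : lam + ε * (2 * (1 - exp (-γ))⁻¹) ^ d ≤ min 2 a := by linarith
  set Kk : ℝ := (2 * (1 - exp (-(2 * κ)))⁻¹) ^ d with hKk
  have hKk0 : 0 ≤ Kk := pow_nonneg (mul_nonneg zero_le_two (inv_nonneg.2 (sub_nonneg.2 (exp_le_one_iff.2 (by linarith))))) d
  refine ⟨((min 2 a - lam) / 4)⁻¹ ^ 2 * (c₁ ^ 2 * exp (2 * d * κ) * Kk) * exp (2 * d * κ) + 1, κ, by positivity, hκ0, ?_⟩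
  intro n s _ V hV hV' K hKs hK ψ hψ y₀
  set T : Matrix (Site d s) (Site d s) ℝ := Matrix.of fun yy y'' : Site d s =>
    (((n : ℝ) + 1) ^ d)⁻¹ * ∑ z : Fin d → Fin (n + 1), ψ y'' (siteOf d ((n + 1) * s) (chart n (windowMap d s yy) z)) with hT_def
  have hvol : (0 : ℝ) < ((n : ℝ) + 1) ^ d := by positivity
  -- (ii) the block-constant display
  have hH : ∀ x : Site d ((n + 1) * s),
      ((n : ℝ) + 1) ^ 2 * ∑ μ, (2 * (∑ y', T⁻¹ y' y₀ * ψ y' x) - (∑ y', T⁻¹ y' y₀ * ψ y' (x + siteOf d ((n + 1) * s) (e μ)))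
          - (∑ y', T⁻¹ y' y₀ * ψ y' (x - siteOf d ((n + 1) * s) (e μ))))
        + a / ((n : ℝ) + 1) ^ d * ∑ q ∈ B n (blk n (windowMap d ((n + 1) * s) x)), (∑ y', T⁻¹ y' y₀ * ψ y' (siteOf d ((n + 1) * s) q))
        + V x * (∑ y', T⁻¹ y' y₀ * ψ y' x) + ∑ z, K x z * (∑ y', T⁻¹ y' y₀ * ψ y' z)
      = T⁻¹ (siteOf d s (blk n (windowMap d ((n + 1) * s) x))) y₀ :=
    fun x => perturbed_superposition_equation n a s V K ψ hψ (fun y' => T⁻¹ y' y₀) x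
  -- (i) the block means
  have hQ : ∀ y : Site d s, (((n : ℝ) + 1) ^ d)⁻¹ * ∑ z : Fin d → Fin (n + 1), (∑ y', T⁻¹ y' y₀
        * ψ y' (siteOf d ((n + 1) * s) (chart n (windowMap d s y) z))) = if y = y₀ then 1 else 0 :=
    fun y => perturbed_response_blockMean n a s ha hLam hε (by linarith) hlam V hV hV' K hKs hK ψ hψ y₀ y
  refine ⟨hQ, hH, fun y => ?_⟩
  -- (iii) block mean square decay
  have hc : ∀ y', |(fun y' => T⁻¹ y' y₀) y'| ≤ c₁ * exp (-(δ₁ * ∑ i, (((y' i - y₀ i).valMinAbs.natAbs : ℕ) : ℝ))) :=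
    fun y' => H166 n s V hV hV' K hKs hK ψ hψ y' y₀
  have hblock := perturbed_blockSq_le_of_decaying_source n a s ha.le hκ0 hκ1 hκγ hε hm h2κ V hV K hK y₀
    (fun x => ∑ y', T⁻¹ y' y₀ * ψ y' x) (fun x => T⁻¹ (siteOf d s (blk n (windowMap d ((n + 1) * s) x))) y₀) hH
    (fun y' => T⁻¹ y' y₀) hc (fun _ => rfl) y
  have h0 : 0 < (min 2 a - lam) / 4 := by linarith
  have hm2 : ((min 2 a - lam - 2 * d * κ ^ 2 - a * (exp (2 * d * κ) - 1) - ε * (2 * (1 - exp (-(γ - κ)))⁻¹) ^ d)⁻¹) ^ 2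
      ≤ ((min 2 a - lam) / 4)⁻¹ ^ 2 :=
    pow_le_pow_left₀ (inv_nonneg.2 (h0.le.trans hfl)) (inv_anti₀ h0 hfl) 2
  rw [inv_mul_le_iff₀ hvol]
  refine hblock.trans ?_
  have hE0 : 0 ≤ exp (-(2 * κ * ∑ i, (((y i - y₀ i).valMinAbs.natAbs : ℕ) : ℝ))) := (exp_pos _).le
  have hP0 : 0 ≤ ((n : ℝ) + 1) ^ d * c₁ ^ 2 * exp (2 * d * κ) * Kk * exp (2 * d * κ)
      * exp (-(2 * κ * ∑ i, (((y i - y₀ i).valMinAbs.natAbs : ℕ) : ℝ))) := by positivity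
  calc ((min 2 a - lam - 2 * d * κ ^ 2 - a * (exp (2 * d * κ) - 1) - ε * (2 * (1 - exp (-(γ - κ)))⁻¹) ^ d)⁻¹) ^ 2
        * ((((n : ℝ) + 1) ^ d * c₁ ^ 2) * exp (2 * d * κ) * Kk) * exp (2 * d * κ)
        * exp (-(2 * κ * ∑ i, (((y i - y₀ i).valMinAbs.natAbs : ℕ) : ℝ)))
      = ((min 2 a - lam - 2 * d * κ ^ 2 - a * (exp (2 * d * κ) - 1) - ε * (2 * (1 - exp (-(γ - κ)))⁻¹) ^ d)⁻¹) ^ 2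
        * (((n : ℝ) + 1) ^ d * c₁ ^ 2 * exp (2 * d * κ) * Kk * exp (2 * d * κ)
        * exp (-(2 * κ * ∑ i, (((y i - y₀ i).valMinAbs.natAbs : ℕ) : ℝ)))) := by ring
    _ ≤ ((min 2 a - lam) / 4)⁻¹ ^ 2 * (((n : ℝ) + 1) ^ d * c₁ ^ 2 * exp (2 * d * κ) * Kk * exp (2 * d * κ)
        * exp (-(2 * κ * ∑ i, (((y i - y₀ i).valMinAbs.natAbs : ℕ) : ℝ)))) := mul_le_mul_of_nonneg_right hm2 hP0
    _ = ((n : ℝ) + 1) ^ d * ((((min 2 a - lam) / 4)⁻¹ ^ 2 * (c₁ ^ 2 * exp (2 * d * κ) * Kk) * exp (2 * d * κ))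
        * exp (-(2 * κ * ∑ i, (((y i - y₀ i).valMinAbs.natAbs : ℕ) : ℝ)))) := by ring
    _ ≤ ((n : ℝ) + 1) ^ d * ((((min 2 a - lam) / 4)⁻¹ ^ 2 * (c₁ ^ 2 * exp (2 * d * κ) * Kk) * exp (2 * d * κ) + 1)
        * exp (-(2 * κ * ∑ i, (((y i - y₀ i).valMinAbs.natAbs : ℕ) : ℝ)))) :=
        mul_le_mul_of_nonneg_left (mul_le_mul_of_nonneg_right (le_add_of_nonneg_right zero_le_one) hE0) hvol.le

/-! ## §4. Toy -/

/-- Toy (`d = 0`, `a = 1`, `λ = 0`, `Λ = 1`, `γ = 2`, `ε = 0`): the constants of the perturbed response letter exist. -/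
example : ∃ C δ : ℝ, 0 < C ∧ 0 < δ :=
  let ⟨C, δ, hC, hδ, _⟩ := perturbed_response_local (d := 0) 1 one_pos (lam := 0) (Lam := 1) (ε := 0) (γ := 2)
    (by norm_num) zero_le_one le_rfl (by norm_num) (by norm_num)
  ⟨C, δ, hC, hδ⟩

end Summit.QuantumFields.BalabanUV.T4Continuum.NE7b.SupTorusPerturbedResponse
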